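import Summits.CriticalPhenomena.PercolationContinuityZ3.Theorems.PercNearOneGluingNoHeavyLowerTailStarSetResidualStar
import Summits.CriticalPhenomena.PercolationContinuityZ3.Theorems.PercNearOneGluingNoHeavyLowerTailStarSetResidualJstar
import HarnessLib

/-!
# `NoHeavyLowerTail` (stmt-CriticalPhenomena-4575) — the data of a residual unit (U1-PROOF.md §§4–6; blueprint §G4)

Support file (prover `prim-gen-swap` gen 15; `--supports stmt-CriticalPhenomena-4575`).  No definitions, no named facts, no sorries.

`StarSet.residual_unit_data` packages, for one RESIDUAL unit `(S, X)` of the U1′_r charging scheme — a charged unit in none of the three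
early families, in the vocabulary of `StarSet.unit_bound_of_residual`'s hypothesis `hR` (abstract `Ω`, `cred`, free rule) — everything
the residual families need: `X` is a chord of `S` avoiding `r` adjacent to all of `S`; `y(S) = 0` (`star_unit_admissible` + the free
rule); the first open forest class `J` is not a child edge and meets `X = {e, ē}` exactly at `e`; the trichotomy R1 / R2-C blocked /
R2-I of `residual_jstar`; and non-regularity at the free end (first clause of (NR)).
-/

namespace Summit.CriticalPhenomena.PercolationContinuityZ3.Theorems

open Finset
open scoped BigOperators Classical

namespace StarSet

variable {ι V : Type*} [Fintype ι] [LinearOrder ι] [DecidableEq V]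

/-- **Data of a residual unit.**  See the file header. -/
theorem residual_unit_data (P P' : ι → V) (hPP' : ∀ X, P X ≠ P' X)
    (hinj : Function.Injective fun X => (s(P X, P' X) : Sym2 V)) (r : V) (F : Finset ι)
    (hforest : ∀ K ∈ F, ∀ I ∈ F, K < I → P' K ≠ P I ∧ P' K ≠ P' I)
    (dom : ι → V → ι)
    (hdom : ∀ X ∉ F, ∀ d, (P X = d ∨ P' X = d) →
      dom X d ∈ F ∧ (P (dom X d) = d ∨ P' (dom X d) = d) ∧
        (∀ u, (P (dom X d) = u ∨ P' (dom X d) = u) → (P X = u ∨ P' X = u) → u = d))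
    (Ω : Finset ι → Finset ι) (hΩ : ∀ S, Ω S = S.filter (fun X => X ∈ (univ \ F).filter (fun κ => P κ ≠ r ∧ P' κ ≠ r) ∧
        ∀ Y ∈ S, (P Y = P X ∨ P Y = P' X ∨ P' Y = P X ∨ P' Y = P' X)))
    (cred : Finset ι → Prop) (hcred : ∀ S, cred S ↔ Ω S = ∅ ∧
      ((∀ I ∈ F, I ∉ S) ∨ ∃ a ∈ F, P a = r ∧ a ∈ S ∧ ∀ b ∈ F, b < a → b ∉ S))
    (free : Finset ι → ι) (hfree : ∀ S, (Ω S).Nonempty → free S ∈ Ω S)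
    (hfreeq : ∀ S, (∃ X ∈ Ω S, ∃ I ∈ F, P' I = r ∧ (P X = P I ∨ P' X = P I)) →
      ∃ I ∈ F, P' I = r ∧ (P (free S) = P I ∨ P' (free S) = P I))
    (S : Finset ι) (X : ι) (hXΩ : X ∈ Ω S)
    (hch : ((∀ I ∈ F, I ∉ S) ∨ ∃ a ∈ F, P a = r ∧ a ∈ S ∧ ∀ b ∈ F, b < a → b ∉ S) → X ≠ free S)
    (hnotri : ¬ ∃ a b c : V, a ≠ b ∧ a ≠ c ∧ b ≠ c ∧ a ≠ r ∧ b ≠ r ∧ c ≠ r ∧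
      (∃ X ∈ S, (s(P X, P' X) : Sym2 V) = s(a, b)) ∧ (∃ Y ∈ S, (s(P Y, P' Y) : Sym2 V) = s(a, c)) ∧
        ∃ Z ∈ S, (s(P Z, P' Z) : Sym2 V) = s(b, c))
    (hnreg : ¬ ∃ Y ∈ S, Y ≠ X ∧ P Y ≠ r ∧ P' Y ≠ r ∧
      ((∃ p, (P X = p ∨ P' X = p) ∧ P Y ≠ p ∧ P' Y ≠ p ∧ P (dom X p) ≠ r ∧ P' (dom X p) ≠ r) ∨
       (Y ∉ F ∧ ∃ s', (P Y = s' ∨ P' Y = s') ∧ P X ≠ s' ∧ P' X ≠ s' ∧ P (dom Y s') ≠ r ∧ P' (dom Y s') ≠ r)))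
    (hnadm : ¬ ∃ d, (P X = d ∨ P' X = d) ∧ P (dom X d) = r ∧ (∃ Y ∈ S, P Y ≠ d ∧ P' Y ≠ d) ∧
      cred (insert (dom X d) (S.erase X))) :
    ∃ J : ι, ∃ e ē : V,
      X ∈ S ∧ X ∉ F ∧ (P X ≠ r ∧ P' X ≠ r) ∧ (∀ Y ∈ S, P Y = P X ∨ P Y = P' X ∨ P' Y = P X ∨ P' Y = P' X) ∧
      ¬ ((∀ I ∈ F, I ∉ S) ∨ ∃ a ∈ F, P a = r ∧ a ∈ S ∧ ∀ b ∈ F, b < a → b ∉ S) ∧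
      J ∈ S ∧ J ∈ F ∧ (∀ I ∈ S, I ∈ F → J ≤ I) ∧ P J ≠ r ∧
      ((P X = e ∧ P' X = ē) ∨ (P X = ē ∧ P' X = e)) ∧ (P J = e ∨ P' J = e) ∧ ¬ (P J = ē ∨ P' J = ē) ∧
      ((P J = e ∧ P' J = r ∧ P (dom X ē) ≠ r ∧ P' (dom X ē) ≠ r) ∨
       (P J ≠ r ∧ P' J ≠ r ∧
        ((P (dom X ē) = r ∧ P' (dom X ē) = ē ∧ J < dom X ē) ∨ (P (dom X ē) = ē ∧ P' (dom X ē) = r)))) ∧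
      (∀ Y ∈ S, Y ≠ X → (P Y ≠ r ∧ P' Y ≠ r) → ∀ p, (P X = p ∨ P' X = p) → (P Y ≠ p ∧ P' Y ≠ p) →
        (P (dom X p) = r ∨ P' (dom X p) = r)) := by
  -- unpack `X ∈ Ω S`
  have hΩmem : ∀ T K, K ∈ Ω T ↔ K ∈ T ∧ (K ∉ F ∧ P K ≠ r ∧ P' K ≠ r) ∧
      ∀ Y ∈ T, (P Y = P K ∨ P Y = P' K ∨ P' Y = P K ∨ P' Y = P' K) := by
    intro T K
    rw [hΩ T, mem_filter, mem_filter, mem_sdiff]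
    simp only [mem_univ, true_and]
  obtain ⟨hXS, ⟨hXF, hXr1, hXr2⟩, hXadj⟩ := (hΩmem S X).1 hXΩ
  -- non-regularity, first clause
  have hNR : ∀ Y ∈ S, Y ≠ X → (P Y ≠ r ∧ P' Y ≠ r) → ∀ p, (P X = p ∨ P' X = p) → (P Y ≠ p ∧ P' Y ≠ p) →
      (P (dom X p) = r ∨ P' (dom X p) = r) := by
    intro Y hYS hYX hYr p hXp hYp
    by_contra hcon
    rw [not_or] at hcon
    exact hnreg ⟨Y, hYS, hYX, hYr.1, hYr.2, Or.inl ⟨p, hXp, hYp.1, hYp.2, hcon.1, hcon.2⟩⟩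
  -- no admissible port, unfolded
  have hnadm' : ∀ d, (P X = d ∨ P' X = d) → P (dom X d) = r → (∃ Y ∈ S, P Y ≠ d ∧ P' Y ≠ d) →
      (∀ μ ∈ insert (dom X d) (S.erase X), μ ∉ F → (P μ ≠ r ∧ P' μ ≠ r) →
        ∃ j ∈ insert (dom X d) (S.erase X), ¬ (P j = P μ ∨ P j = P' μ ∨ P' j = P μ ∨ P' j = P' μ)) →
      ¬ ((∀ I ∈ F, I ∉ insert (dom X d) (S.erase X)) ∨
        ∃ a ∈ F, P a = r ∧ a ∈ insert (dom X d) (S.erase X) ∧ ∀ b ∈ F, b < a → b ∉ insert (dom X d) (S.erase X)) := by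
    intro d hXd hdr hY hΩe hy1
    refine hnadm ⟨d, hXd, hdr, hY, (hcred _).2 ⟨?_, hy1⟩⟩
    refine eq_empty_of_forall_notMem fun μ hμ => ?_
    obtain ⟨hμT, ⟨hμF, hμr1, hμr2⟩, hμadj⟩ := (hΩmem _ μ).1 hμ
    obtain ⟨j, hj, hjadj⟩ := hΩe μ hμT hμF ⟨hμr1, hμr2⟩
    exact hjadj (hμadj j hj)
  -- `y(S) = 0`: otherwise the unit is a STAR unit, hence admissible
  have hy0 : ¬ ((∀ I ∈ F, I ∉ S) ∨ ∃ a ∈ F, P a = r ∧ a ∈ S ∧ ∀ b ∈ F, b < a → b ∉ S) := by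
    intro hy
    have hfS := hfree S ⟨X, hXΩ⟩
    obtain ⟨hfS', ⟨hfF, hfr1, hfr2⟩, hfadj⟩ := (hΩmem S (free S)).1 hfS
    have hfX : free S ≠ X := fun h => hch hy h.symm
    obtain ⟨d, hXd, hdr, hY, hΩe, hy1⟩ := star_unit_admissible P P' hPP' hinj r F dom
      (fun K hK d hd => ⟨(hdom K hK d hd).1, (hdom K hK d hd).2.1⟩) S hXS hXF ⟨hXr1, hXr2⟩ hXadj hfS' hfX ⟨hfr1, hfr2⟩ hfadj
      (fun I hIF hIr hXI => by
        obtain ⟨I', hI'F, hI'r, hfI'⟩ := hfreeq S ⟨X, hXΩ, I, hIF, hIr, hXI⟩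
        have hII' : I' = I := leafClass_unique P P' r F hforest hI'F hI'r hIF hIr
        rw [hII'] at hfI'
        exact hfI')
      hnotri hy (fun p hXp hfp => hNR (free S) hfS' hfX ⟨hfr1, hfr2⟩ p hXp hfp)
    exact hnadm' d hXd hdr hY hΩe hy1
  -- the first open forest class
  have hne : (S.filter (· ∈ F)).Nonempty := by
    by_contra h
    rw [not_nonempty_iff_eq_empty] at h
    exact hy0 (Or.inl fun I hIF hIS => by
      have : I ∈ S.filter (· ∈ F) := mem_filter.2 ⟨hIS, hIF⟩
      rw [h] at this; exact absurd this (notMem_empty I))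
  set J := (S.filter (· ∈ F)).min' hne with hJdef
  have hJ := min'_mem _ hne
  have hJS : J ∈ S := (mem_filter.1 hJ).1
  have hJF : J ∈ F := (mem_filter.1 hJ).2
  have hJmin : ∀ I ∈ S, I ∈ F → J ≤ I := fun I hI hIF => min'_le _ I (mem_filter.2 ⟨hI, hIF⟩)
  obtain ⟨hJr, e, ē, hX, hJe, hJē, htri⟩ := residual_jstar P P' hPP' hinj r F hforest dom hdom S hXS hXF ⟨hXr1, hXr2⟩ hXadj
    hnotri hy0 hNR hnadm' hJS hJF hJmin
  exact ⟨J, e, ē, hXS, hXF, ⟨hXr1, hXr2⟩, hXadj, hy0, hJS, hJF, hJmin, hJr, hX, hJe, hJē, htri, hNR⟩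

end StarSet

end Summit.CriticalPhenomena.PercolationContinuityZ3.Theorems
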